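import Summits.Parity.GeneralizedHardyLittlewood.Theorems.GreenTaoLevelTwoGITwoCyclicInverseBracketFormFreq
import Summits.Parity.GeneralizedHardyLittlewood.Theorems.GreenTaoLevelTwoGITwoCyclicInverseBracketFunctions

/-!
# Route `GreenTaoLevelTwo`, crux `GITwo` (stmt-Parity-21275), line `birth`, stub `stub_cyclicInverse`:
# aggregating the bracket quadratic `M(x)·x` into `d²` monomials (GT08a arXiv Prop. 54 / (phi-expand))

Seventy-fifth helper file toward the XL stub `stub_cyclicInverse` (B. Green, T. Tao, *An inverse
theorem for the Gowers `U³(G)` norm*, arXiv:math/0503014, Thm. 68 = PEMS 51 (2008) Thm. 12.8).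
Block E17 (arXiv §12, (phi-expand): "`φ(n) := ∑_{ξ,ξ'∈S} a_{ξ,ξ'}{ξ·n}{ξ'·n} + ∑_{ξ∈S} a_ξ{ξ·n}`"):
`…BracketFormFreq` writes `e(M(x)x/N)` as a product over `(i,j,l,l')`; collecting the coefficients
`A_{ll'} = N ∑_{i,j} a_{il} a_{jl'} valMinAbs(M(vᵢ)vⱼ)` gives the `d²` monomials
`e(A_{ll'} {ξ_l x/N}{ξ_{l'} x/N})` in the `toCircle` form consumed by `exists_bracket_quad_monomial`,
and likewise `e(M(x)·w/N) = ∏_l e(B_l {ξ_l x/N})`, `B_l = ∑_j a_{jl} valMinAbs(M(vⱼ)w)`, for the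
linear part (`exists_bracket_linear_monomial`).  Def-free:

* `sum_sum_coord_mul_coord_eq` — the real identity `∑_{ij} cᵢcⱼθᵢⱼ = ∑_{ll'} m_l m_{l'} ∑_{ij} a_{il}a_{jl'}θᵢⱼ`
  for `cⱼ = ∑_l a_{jl} m_l`;
* `stdAddChar_mul_self_eq_prod_monomials` — `e(M(x)x/N) = ∏_l ∏_{l'} toCircle↑(A_{ll'}·(m_l/N)·(m_{l'}/N))`;
* `stdAddChar_mul_eq_prod_linear` — `e(M(x)w/N) = ∏_l toCircle↑(B_l·(m_l/N))`.

References: [GreenTao2008U3Inverse] arXiv:math/0503014, §10 Prop. 54, §12 (phi-expand).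
-/

noncomputable section

namespace Summit.Parity.GeneralizedHardyLittlewood.GreenTaoLevelTwoGITwoCyclicInverse

open Finset

/-- The real identity behind the aggregation: for `cⱼ = ∑_l a_{jl} m_l`,
`∑ᵢ∑ⱼ cᵢ cⱼ θᵢⱼ = ∑_l ∑_{l'} m_l m_{l'} (∑ᵢ∑ⱼ a_{il} a_{jl'} θᵢⱼ)`. [folklore] -/
theorem sum_sum_coord_mul_coord_eq {d : ℕ} (a : Fin d → Fin d → ℝ) (m : Fin d → ℝ)
    (θ : Fin d → Fin d → ℝ) {c : Fin d → ℝ} (hdual : ∀ j, c j = ∑ l, a j l * m l) :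
    ∑ i, ∑ j, c i * c j * θ i j = ∑ l, ∑ l', m l * m l' * ∑ i, ∑ j, a i l * a j l' * θ i j := by
  -- expand both sides into the quadruple sum `∑ t i j l l'`
  have hL : ∑ i, ∑ j, c i * c j * θ i j =
      ∑ i, ∑ j, ∑ l, ∑ l', a i l * m l * (a j l' * m l') * θ i j := by
    refine sum_congr rfl fun i _ => sum_congr rfl fun j _ => ?_
    rw [hdual i, hdual j, sum_mul, sum_mul]
    refine sum_congr rfl fun l _ => ?_
    rw [mul_sum, sum_mul]
  have hR : ∑ l, ∑ l', m l * m l' * ∑ i, ∑ j, a i l * a j l' * θ i j =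
      ∑ l, ∑ l', ∑ i, ∑ j, a i l * m l * (a j l' * m l') * θ i j := by
    refine sum_congr rfl fun l _ => sum_congr rfl fun l' _ => ?_
    rw [mul_sum]
    refine sum_congr rfl fun i _ => ?_
    rw [mul_sum]
    exact sum_congr rfl fun j _ => by ring
  rw [hL, hR]
  -- reorder: (i, j, l, l') → (l, l', i, j)
  calc ∑ i, ∑ j, ∑ l, ∑ l', a i l * m l * (a j l' * m l') * θ i j
      = ∑ i, ∑ l, ∑ j, ∑ l', a i l * m l * (a j l' * m l') * θ i j :=
        sum_congr rfl fun i _ => Finset.sum_comm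
    _ = ∑ l, ∑ i, ∑ j, ∑ l', a i l * m l * (a j l' * m l') * θ i j := Finset.sum_comm
    _ = ∑ l, ∑ i, ∑ l', ∑ j, a i l * m l * (a j l' * m l') * θ i j :=
        sum_congr rfl fun l _ => sum_congr rfl fun i _ => Finset.sum_comm
    _ = ∑ l, ∑ l', ∑ i, ∑ j, a i l * m l * (a j l' * m l') * θ i j :=
        sum_congr rfl fun l _ => Finset.sum_comm

/-- **Aggregation of the quadratic part (arXiv (phi-expand)).**  If `x = ∑ cⱼvⱼ`,
`M x = ∑ cⱼ M(vⱼ)` and `cⱼ = ∑_l a_{jl} valMinAbs(xξ_l)`, then with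
`A_{ll'} = N ∑ᵢ∑ⱼ a_{il} a_{jl'} valMinAbs(M(vᵢ)vⱼ)`:
`e(M(x)x/N) = ∏_l ∏_{l'} toCircle↑(A_{ll'} · (valMinAbs(xξ_l)/N) · (valMinAbs(xξ_{l'})/N))`.
[cite: GreenTao2008U3Inverse, §12, (phi-expand)] -/
theorem stdAddChar_mul_self_eq_prod_monomials {N : ℕ} [NeZero N] {d : ℕ} (ξ : Fin d → ZMod N)
    (c : Fin d → ℤ) (v : Fin d → ZMod N) (μ : ZMod N → ZMod N) {x : ZMod N}
    (hx : x = ∑ j, (c j : ZMod N) * v j) (hμ : μ x = ∑ j, (c j : ZMod N) * μ (v j))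
    {a : Fin d → Fin d → ℝ} (hdual : ∀ j, (c j : ℝ) = ∑ l, a j l * ((x * ξ l).valMinAbs : ℝ)) :
    (ZMod.stdAddChar (μ x * x) : ℂ) =
      ∏ l, ∏ l', ((AddCircle.toCircle ((((N * ∑ i, ∑ j, a i l * a j l' *
          ((μ (v i) * v j).valMinAbs : ℝ)) * (((x * ξ l).valMinAbs : ℝ) / N) *
          (((x * ξ l').valMinAbs : ℝ) / N) : ℝ)) : AddCircle (1 : ℝ)) : Circle) : ℂ) := by
  have hNne : (N : ℝ) ≠ 0 := by exact_mod_cast NeZero.ne N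
  rw [stdAddChar_mul_self_eq_prod_coords c v μ hx hμ]
  -- both sides are `exp (2πi · S)` for the same real `S`
  simp_rw [toCircle_coe_eq_exp, ← Complex.exp_sum]
  congr 1
  have key := sum_sum_coord_mul_coord_eq a (fun l => ((x * ξ l).valMinAbs : ℝ))
    (fun i j => ((μ (v i) * v j).valMinAbs : ℝ)) hdual
  -- pull out `2πi` and `/N`, compare the real sums
  have hL : ∑ i, ∑ j, (2 * Real.pi * Complex.I *
      (((c i : ℝ) : ℂ) * ((c j : ℝ) : ℂ) * ((((μ (v i) * v j).valMinAbs : ℝ) : ℂ) / N))) =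
      2 * Real.pi * Complex.I * (((∑ i, ∑ j, (c i : ℝ) * (c j : ℝ) *
        ((μ (v i) * v j).valMinAbs : ℝ)) / N : ℝ) : ℂ) := by
    push_cast
    rw [Finset.sum_div, Finset.mul_sum]
    refine sum_congr rfl fun i _ => ?_
    rw [Finset.sum_div, Finset.mul_sum]
    refine sum_congr rfl fun j _ => ?_
    ring
  have hR : ∑ l, ∑ l', (2 * Real.pi * Complex.I *
      (((N * ∑ i, ∑ j, a i l * a j l' * ((μ (v i) * v j).valMinAbs : ℝ)) *
        (((x * ξ l).valMinAbs : ℝ) / N) * (((x * ξ l').valMinAbs : ℝ) / N) : ℝ) : ℂ)) =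
      2 * Real.pi * Complex.I * (((∑ l, ∑ l', ((x * ξ l).valMinAbs : ℝ) * ((x * ξ l').valMinAbs : ℝ) *
        ∑ i, ∑ j, a i l * a j l' * ((μ (v i) * v j).valMinAbs : ℝ)) / N : ℝ) : ℂ) := by
    rw [Finset.sum_div]
    push_cast
    rw [Finset.mul_sum]
    refine sum_congr rfl fun l _ => ?_
    rw [Finset.sum_div, Finset.mul_sum]
    refine sum_congr rfl fun l' _ => ?_
    field_simp
  rw [hL, hR, key]

/-- **Aggregation of the linear part**: if `M x = ∑ cⱼ M(vⱼ)` and `cⱼ = ∑_l a_{jl} valMinAbs(xξ_l)`,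
then for every `w`, with `B_l = ∑ⱼ a_{jl} valMinAbs(M(vⱼ) w)`:
`e(M(x)·w/N) = ∏_l toCircle↑(B_l · (valMinAbs(xξ_l)/N))`. [cite: GreenTao2008U3Inverse, §12, (phi-expand)] -/
theorem stdAddChar_mul_eq_prod_linear {N : ℕ} [NeZero N] {d : ℕ} (ξ : Fin d → ZMod N)
    (c : Fin d → ℤ) (v : Fin d → ZMod N) (μ : ZMod N → ZMod N) {x : ZMod N} (w : ZMod N)
    (hμ : μ x = ∑ j, (c j : ZMod N) * μ (v j))
    {a : Fin d → Fin d → ℝ} (hdual : ∀ j, (c j : ℝ) = ∑ l, a j l * ((x * ξ l).valMinAbs : ℝ)) :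
    (ZMod.stdAddChar (μ x * w) : ℂ) =
      ∏ l, ((AddCircle.toCircle ((((∑ j, a j l * ((μ (v j) * w).valMinAbs : ℝ)) *
          (((x * ξ l).valMinAbs : ℝ) / N) : ℝ)) : AddCircle (1 : ℝ)) : Circle) : ℂ) := by
  have hNne : (N : ℝ) ≠ 0 := by exact_mod_cast NeZero.ne N
  rw [hμ, stdAddChar_sum_coords_mul_eq c (fun j => μ (v j)) w]
  simp_rw [toCircle_coe_eq_exp, ← Complex.exp_sum]
  congr 1
  -- `∑_j c_j k_j / N = ∑_l m_l/N · ∑_j a_jl k_j`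
  have hreal : ∑ j, (c j : ℝ) * ((μ (v j) * w).valMinAbs : ℝ) / N =
      ∑ l, (∑ j, a j l * ((μ (v j) * w).valMinAbs : ℝ)) * (((x * ξ l).valMinAbs : ℝ) / N) := by
    have h1 : ∑ j, (c j : ℝ) * ((μ (v j) * w).valMinAbs : ℝ) / N =
        ∑ j, ∑ l, a j l * ((x * ξ l).valMinAbs : ℝ) * ((μ (v j) * w).valMinAbs : ℝ) / N := by
      refine sum_congr rfl fun j _ => ?_
      rw [hdual j, sum_mul, sum_div]
    rw [h1, Finset.sum_comm]
    refine sum_congr rfl fun l _ => ?_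
    rw [sum_mul]
    refine sum_congr rfl fun j _ => ?_
    field_simp
  have hL : ∑ j, (2 * Real.pi * Complex.I *
      (((c j : ℝ) : ℂ) * ((((μ (v j) * w).valMinAbs : ℝ)) : ℂ) / N)) =
      2 * Real.pi * Complex.I * ((∑ j, (c j : ℝ) * ((μ (v j) * w).valMinAbs : ℝ) / N : ℝ) : ℂ) := by
    push_cast
    rw [Finset.mul_sum]
  have hR : ∑ l, (2 * Real.pi * Complex.I *
      ((((∑ j, a j l * ((μ (v j) * w).valMinAbs : ℝ)) * (((x * ξ l).valMinAbs : ℝ) / N) : ℝ)) : ℂ)) =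
      2 * Real.pi * Complex.I * ((∑ l, (∑ j, a j l * ((μ (v j) * w).valMinAbs : ℝ)) *
        (((x * ξ l).valMinAbs : ℝ) / N) : ℝ) : ℂ) := by
    push_cast
    rw [Finset.mul_sum]
  rw [hL, hR, hreal]

end Summit.Parity.GeneralizedHardyLittlewood.GreenTaoLevelTwoGITwoCyclicInverse
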